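import Summits.QuantumAdvantage.QuantumAdvantage.Theorems.PerceptronDialLawsC

/-! # PerceptronDialLaws — part 4/4 (mechanical split for landing of `PerceptronDialLaws`; content verbatim; scopes re-opened with their variables) -/

set_option linter.dupNamespace false
noncomputable section

namespace Summit.QuantumAdvantage.QuantumAdvantage.Theorems.PerceptronDial
open Finset
open Literature.Computability.Complexity
open Literature.Computability.QuantumComplexity
open Literature.Computability.QuantumComplexity.BuzetChailloux (bxor zeroVec)
open Summit.QuantumAdvantage.QuantumAdvantage.Theses.AnfPresentation
open Summit.QuantumAdvantage.QuantumAdvantage.Theorems.HintDial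
open Summit.QuantumAdvantage.QuantumAdvantage.Theorems.HintDial.Automaton
open Summit.QuantumAdvantage.QuantumAdvantage.Theorems.HintDial (bit_xor bit_and bit_not bit_eq_ite bit_decide_odd bit_injective bit_mul_self bit_false eval_bit)
open CubicForm (bit)
open DerivativeWalsh (W)
open Summit.QuantumAdvantage.QuantumAdvantage.Theorems.PebbleDial (AnfIdx bitsFG bits)
variable {n k : ℕ}

section QKey
variable {k : ℕ}
variable {c : Bool} {α β : Fin k → Bool} {M N B : Fin k → Fin k → Bool}

/-! ### The face: parameters `(s, t, B, b)`, instance `(F_{s,t,B}, F̃_{s,t,B} ⊕ b)` -/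

/-- the parameter space at scale `m`: shift `s`, linear key `t`, quadratic key `B`, label `b` -/
abbrev QParam (m : ℕ) : Type := (Fin m → Bool) × (Fin m → Bool) × (Fin m → Fin m → Bool) × Bool

/-- the F-form of the face: `F_{s,t,B}(x′,x″) = ⟨s,x′⟩ ⊕ ⟨x′,x″⟩ ⊕ ⟨t,x″⟩ ⊕ Q_B(x″)` -/
def faceF (m : ℕ) (w : QParam m) : CubicForm (m + m) := qF m false w.1 (δ m) w.2.1 w.2.2.1

/-- the TABLE of the dual `F̃_{s,t,B}`, namely (polarisation)
`G₀(y′,y″) = [⟨t,s⟩ ⊕ Q_B(s)] ⊕ ⟨t ⊕ polar_B s, y′⟩ ⊕ Q_B(y′) ⊕ ⟨y′,y″⟩ ⊕ ⟨s,y″⟩`. -/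
def faceG₀ (m : ℕ) (s t : Fin m → Bool) (B : Fin m → Fin m → Bool) : CubicForm (m + m) :=
  qTable m (xor (bd t s) (qf B s)) (bxor t (polar B s)) B (δ m) s zm

/-- the G-form of the face: the table of `F̃_{s,t,B} ⊕ b`. -/
def faceG (m : ℕ) (w : QParam m) : CubicForm (m + m) :=
  if w.2.2.2 then flipConst (faceG₀ m w.1 w.2.1 w.2.2.1) else faceG₀ m w.1 w.2.1 w.2.2.1

/-- the planted instance -/
def faceInst (m : ℕ) (w : QParam m) : CubicANFPair := ⟨m + m, faceF m w, faceG m w⟩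

/-- PerceptronDialLaws helper `eval_faceG_dual` (decomp-qadv land package; see the module docstring). -/
theorem eval_faceG_dual (m : ℕ) (s t : Fin m → Bool) (B : Fin m → Fin m → Bool) :
    (faceG₀ m s t B).eval = dualQ false s (δ m) t B := by
  funext y
  obtain ⟨⟨y₁, y₂⟩, rfl⟩ := (Fin.appendEquiv m m).surjective y
  show (faceG₀ m s t B).eval (Fin.append y₁ y₂) = dualQ false s (δ m) t B (Fin.append y₁ y₂)
  rw [faceG₀, eval_qTable, dualQ_append, mv_δ, mv_δ, qf_zm, qf_bxor B s y₁, bd_bxor_right, bd_bxor_left, bd_bxor_left,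
    bd_comm (polar B s) y₁]
  simp only [Bool.false_xor, Bool.xor_false]
  generalize bd t s = P; generalize qf B s = Q; generalize bd t y₁ = R; generalize bd y₁ (polar B s) = U
  generalize qf B y₁ = V; generalize bd y₁ y₂ = X; generalize bd s y₂ = Y
  cases P <;> cases Q <;> cases R <;> cases U <;> cases V <;> cases X <;> cases Y <;> rfl

/-- ★ exactness, YES: `Φ(F_{s,t,B}, F̃_{s,t,B}) = 1`. -/
theorem value_faceInst_false (m : ℕ) (s t : Fin m → Bool) (B : Fin m → Fin m → Bool) :
    (faceInst m (s, t, B, false)).value = 1 := by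
  show forrelation (faceF m (s, t, B, false)).eval (faceG m (s, t, B, false)).eval = 1
  rw [show (faceG m (s, t, B, false)).eval = (faceG₀ m s t B).eval from rfl, eval_faceG_dual]
  exact forrelation_eq_one_of_isDualOf (isDualOf_qF (c := false) (α := s) (M := δ m) (N := δ m) (β := t) (B := B)
    fun x => by rw [mv_δ, mv_δ])

/-- ★ exactness, NO: `Φ(F_{s,t,B}, F̃_{s,t,B} ⊕ 1) = -1`. -/
theorem value_faceInst_true (m : ℕ) (s t : Fin m → Bool) (B : Fin m → Fin m → Bool) :
    (faceInst m (s, t, B, true)).value = -1 := by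
  have e : faceG m (s, t, B, true) = flipConst (faceG m (s, t, B, false)) := rfl
  show (⟨m + m, faceF m (s, t, B, true), faceG m (s, t, B, true)⟩ : CubicANFPair).value = -1
  rw [e, show faceF m (s, t, B, true) = faceF m (s, t, B, false) from rfl, value_flipConst]
  exact congrArg Neg.neg (value_faceInst_false m s t B)

/-- PerceptronDialLaws helper `value_faceInst` (decomp-qadv land package; see the module docstring). -/
theorem value_faceInst (m : ℕ) (w : QParam m) : (faceInst m w).value = signOf w.2.2.2 := by
  obtain ⟨s, t, B, b⟩ := w
  cases b
  · rw [value_faceInst_false]; rfl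
  · rw [value_faceInst_true]; simp [signOf]

/-- PerceptronDialLaws helper `card_QParam_yes` (decomp-qadv land package; see the module docstring). -/
theorem card_QParam_yes (m : ℕ) :
    Fintype.card (QParam m) = 2 * (univ.filter fun w : QParam m => w.2.2.2 = false).card := by
  classical
  have h : (univ.filter fun w : QParam m => w.2.2.2 = false)
      = (univ : Finset ((Fin m → Bool) × (Fin m → Bool) × (Fin m → Fin m → Bool))).map
          ⟨fun v => (v.1, v.2.1, v.2.2, false), fun v v' e => by simpa [Prod.ext_iff] using e⟩ := by
    ext ⟨s, t, B, b⟩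
    simp only [mem_filter, mem_univ, true_and, mem_map, Function.Embedding.coeFn_mk, Prod.mk.injEq]
    constructor
    · rintro rfl; exact ⟨(s, t, B), rfl, rfl, rfl, rfl⟩
    · rintro ⟨v, rfl, rfl, rfl, h⟩; exact h.symm
  rw [h, card_map, card_univ]
  simp only [QParam, Fintype.card_prod, Fintype.card_bool]
  ring

/-- ★★ THE QUADRATIC-KEY FACE (a `QFace`): exact, total, balanced. -/
def qkeyFace : QFace QParam where
  arity m := m + m
  formF := faceF
  formG := faceG
  sgn _ w := w.2.2.2
  nonempty _ := ⟨(zeroVec, zeroVec, zm, false)⟩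
  even m := ⟨m, rfl⟩
  value_eq := value_faceInst
  balanced m := (card_QParam_yes m).le

/-- ★★ [W₂'s first lemma · UNDECIDED(test) · ATTACKABLE] `KeyBias`: on the quadratic-key face, for every polynomial `p` and all large
scales, EVERY quadratic phase of the table bits — i.e. every degree-`≤ 2` polynomial over `𝔽₂` in the visible data
`(s, t, B, t ⊕ polar_B s)` and the one label-carrying bit `g₀ = b ⊕ ⟨t,s⟩ ⊕ Q_B(s)` — predicts the label `b` with advantage
`< 1/(2p(2m))`.  Equivalently (splitting off `g₀`): the key-form value `Q_B(s)` has correlation `< 1/poly` with every quadratic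
polynomial in `(s, t, B, polar_B s)` under uniform `(s,t,B)`. -/
def KeyBias : Prop := qkeyFace.QuadUncorrelated

/-- ★★★ [the W₂ line, kernel] `KeyBias → VoteRung2NU → VoteRung2`. -/
theorem voteRung2NU_of_keyBias (h : KeyBias) : VoteRung2NU := voteRung2NU_of_face qkeyFace h

/-- PerceptronDialLaws helper `voteRung2_of_keyBias` (decomp-qadv land package; see the module docstring). -/
theorem voteRung2_of_keyBias (h : KeyBias) : VoteRung2 := voteRung2_of_voteRung2NU (voteRung2NU_of_keyBias h)

end QKey

/-! ## §9 `CoreBias`: the presentation-free exponential-sum form of `KeyBias`, and the certified edge `CoreBias → KeyBias`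

The visible data of the face instance `(F_{s,t,B}, F̃_{s,t,B} ⊕ b)` are AFFINE in five families of `𝔽₂`-variables —
`s_a`, `t_a`, `B_{aa'}` (upper-triangular read), `p_a := polar_B(s)_a = ((U_B+U_Bᵀ)s)_a` and the ONE label-carrying bit
`c_G := b ⊕ ⟨t,s⟩ ⊕ Q_B(s)` (the constant of the `G`-table) — every table bit is `0`, `1`, one of these variables, or
`t_a ⊕ p_a` (`isAffIn_bits`).  Hence every quadratic phase gate of the table bits is a quadratic polynomial in these
variables (`isQuadIn_qphase`), and `KeyBias` follows from the bare exponential-sum statement `CoreBias` below, which mentions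
no table, no slice and no circuit (`keyBias_of_coreBias`, kernel-checked).  NODE-g16.md §4.6 records the pen-and-paper
reductions beneath it (`c_G` splits off: `ρ(m) = max_{q₀} |E(-1)^{⟨t,s⟩+Q_B(s)+q₀(s,t,B,p)}|`; the CUT LAW; the Gowers-`U³` route
and its rank instrument). -/

section Core

variable {k : ℕ} {Ω ι : Type} [Fintype ι]

/-- an affine polynomial over `𝔽₂` in variables `ι` -/
structure AffP (ι : Type) where
  c : ZMod 2
  l : ι → ZMod 2

/-- a quadratic polynomial over `𝔽₂` in variables `ι` (the pair coefficients are read over ordered pairs, `xᵢxᵢ = xᵢ`) -/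
structure QuadP (ι : Type) where
  c : ZMod 2
  l : ι → ZMod 2
  q : ι → ι → ZMod 2

/-- evaluation of an affine polynomial at a Boolean point -/
def AffP.ev (A : AffP ι) (x : ι → Bool) : ZMod 2 := A.c + ∑ i, A.l i * bit (x i)

/-- evaluation of a quadratic polynomial at a Boolean point -/
def QuadP.ev (P : QuadP ι) (x : ι → Bool) : ZMod 2 :=
  P.c + ∑ i, P.l i * bit (x i) + ∑ i, ∑ j, P.q i j * (bit (x i) * bit (x j))

/-- `f : Ω → Bool` IS an affine polynomial in the variables valued by `v` -/
def IsAffIn (v : Ω → ι → Bool) (f : Ω → Bool) : Prop := ∃ A : AffP ι, ∀ w, bit (f w) = A.ev (v w)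

/-- `f : Ω → Bool` IS a quadratic polynomial in the variables valued by `v` -/
def IsQuadIn (v : Ω → ι → Bool) (f : Ω → Bool) : Prop := ∃ P : QuadP ι, ∀ w, bit (f w) = P.ev (v w)

variable (v : Ω → ι → Bool)

/-- PerceptronDialLaws helper `IsAffIn.of_eq` (decomp-qadv land package; see the module docstring). -/
theorem IsAffIn.of_eq {f g : Ω → Bool} (h : ∀ w, f w = g w) (hg : IsAffIn v g) : IsAffIn v f := by
  obtain ⟨A, hA⟩ := hg; exact ⟨A, fun w => by rw [h w, hA]⟩

/-- PerceptronDialLaws helper `IsQuadIn.of_eq` (decomp-qadv land package; see the module docstring). -/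
theorem IsQuadIn.of_eq {f g : Ω → Bool} (h : ∀ w, f w = g w) (hg : IsQuadIn v g) : IsQuadIn v f := by
  obtain ⟨P, hP⟩ := hg; exact ⟨P, fun w => by rw [h w, hP]⟩

/-- PerceptronDialLaws helper `isAffIn_const` (decomp-qadv land package; see the module docstring). -/
theorem isAffIn_const (c : Bool) : IsAffIn v (fun _ => c) :=
  ⟨⟨bit c, fun _ => 0⟩, fun w => by simp [AffP.ev]⟩

/-- PerceptronDialLaws helper `isAffIn_var` (decomp-qadv land package; see the module docstring). -/
theorem isAffIn_var [DecidableEq ι] (i : ι) : IsAffIn v (fun w => v w i) :=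
  ⟨⟨0, fun j => if i = j then 1 else 0⟩, fun w => by simp [AffP.ev, ite_mul, Finset.sum_ite_eq]⟩

/-- PerceptronDialLaws helper `isAffIn_xor` (decomp-qadv land package; see the module docstring). -/
theorem isAffIn_xor {f g : Ω → Bool} (hf : IsAffIn v f) (hg : IsAffIn v g) : IsAffIn v (fun w => xor (f w) (g w)) := by
  obtain ⟨A, hA⟩ := hf; obtain ⟨B, hB⟩ := hg
  refine ⟨⟨A.c + B.c, fun i => A.l i + B.l i⟩, fun w => ?_⟩
  rw [bit_xor, hA, hB]
  simp only [AffP.ev, add_mul, sum_add_distrib]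
  ring

/-- `[d] ∧ f` for a fixed Boolean `d` -/
theorem isAffIn_const_and {f : Ω → Bool} (d : Bool) (hf : IsAffIn v f) : IsAffIn v (fun w => d && f w) := by
  cases d
  · exact IsAffIn.of_eq v (g := fun _ => false) (fun w => by simp) (isAffIn_const v false)
  · exact IsAffIn.of_eq v (g := f) (fun w => by simp) hf

/-- PerceptronDialLaws helper `isQuadIn_of_isAffIn` (decomp-qadv land package; see the module docstring). -/
theorem isQuadIn_of_isAffIn {f : Ω → Bool} (hf : IsAffIn v f) : IsQuadIn v f := by
  obtain ⟨A, hA⟩ := hf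
  exact ⟨⟨A.c, A.l, fun _ _ => 0⟩, fun w => by rw [hA]; simp [AffP.ev, QuadP.ev]⟩

/-- PerceptronDialLaws helper `isQuadIn_xor` (decomp-qadv land package; see the module docstring). -/
theorem isQuadIn_xor {f g : Ω → Bool} (hf : IsQuadIn v f) (hg : IsQuadIn v g) : IsQuadIn v (fun w => xor (f w) (g w)) := by
  obtain ⟨A, hA⟩ := hf; obtain ⟨B, hB⟩ := hg
  refine ⟨⟨A.c + B.c, fun i => A.l i + B.l i, fun i j => A.q i j + B.q i j⟩, fun w => ?_⟩
  rw [bit_xor, hA, hB]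
  simp only [QuadP.ev, add_mul, sum_add_distrib]
  ring

/-- ★ the product of two affine polynomials is a quadratic polynomial -/
theorem isQuadIn_and {f g : Ω → Bool} (hf : IsAffIn v f) (hg : IsAffIn v g) : IsQuadIn v (fun w => f w && g w) := by
  obtain ⟨A, hA⟩ := hf; obtain ⟨B, hB⟩ := hg
  refine ⟨⟨A.c * B.c, fun i => A.c * B.l i + B.c * A.l i, fun i j => A.l i * B.l j⟩, fun w => ?_⟩
  rw [bit_and, hA, hB]
  simp only [AffP.ev, QuadP.ev]
  set x := v w
  have e1 : (A.c + ∑ i, A.l i * bit (x i)) * (B.c + ∑ j, B.l j * bit (x j))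
      = A.c * B.c + (∑ i, A.c * B.l i * bit (x i) + ∑ i, B.c * A.l i * bit (x i))
        + ∑ i, ∑ j, A.l i * B.l j * (bit (x i) * bit (x j)) := by
    rw [add_mul, mul_add, mul_add, Finset.sum_mul_sum, mul_sum, sum_mul]
    have h3 : ∑ i, ∑ j, A.l i * bit (x i) * (B.l j * bit (x j)) = ∑ i, ∑ j, A.l i * B.l j * (bit (x i) * bit (x j)) :=
      sum_congr rfl fun i _ => sum_congr rfl fun j _ => by ring
    have h1 : ∑ i, A.c * (B.l i * bit (x i)) = ∑ i, A.c * B.l i * bit (x i) := sum_congr rfl fun i _ => by ring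
    have h2 : ∑ i, A.l i * bit (x i) * B.c = ∑ i, B.c * A.l i * bit (x i) := sum_congr rfl fun i _ => by ring
    rw [h1, h2, h3]; ring
  rw [e1]
  simp only [add_mul, sum_add_distrib]

/-- bit semantics of a quadratic phase gate -/
theorem bit_qphase {n : ℕ} (c : Bool) (S : Finset (AnfIdx n × AnfIdx n)) (x : AnfIdx n → Bool) :
    bit (qphase c S x) = bit c + ∑ ij ∈ S, bit (x ij.1) * bit (x ij.2) := by
  rw [qphase, bit_xor, bit_decide_odd, Finset.natCast_card_filter]
  refine congrArg _ (sum_congr rfl fun ij _ => ?_)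
  rw [← bit_eq_ite, bit_and]

/-- PerceptronDialLaws helper `qphase_insert` (decomp-qadv land package; see the module docstring). -/
theorem qphase_insert {n : ℕ} (c : Bool) {S : Finset (AnfIdx n × AnfIdx n)} {a : AnfIdx n × AnfIdx n} (ha : a ∉ S)
    (x : AnfIdx n → Bool) : qphase c (insert a S) x = xor (x a.1 && x a.2) (qphase c S x) :=
  bit_injective (by rw [bit_qphase, bit_xor, bit_and, bit_qphase, sum_insert ha]; ring)

/-- PerceptronDialLaws helper `qphase_empty` (decomp-qadv land package; see the module docstring). -/
theorem qphase_empty {n : ℕ} (c : Bool) (x : AnfIdx n → Bool) : qphase c ∅ x = c :=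
  bit_injective (by rw [bit_qphase]; simp)

/-- ★ a quadratic phase gate applied to AFFINE coordinates is a quadratic polynomial -/
theorem isQuadIn_qphase {n : ℕ} {y : Ω → AnfIdx n → Bool} (hy : ∀ i, IsAffIn v (fun w => y w i)) (c : Bool)
    (S : Finset (AnfIdx n × AnfIdx n)) : IsQuadIn v (fun w => qphase c S (y w)) := by
  classical
  induction S using Finset.induction_on with
  | empty => exact IsQuadIn.of_eq v (fun w => qphase_empty c (y w)) (isQuadIn_of_isAffIn v (isAffIn_const v c))
  | insert a S ha ih =>
      exact IsQuadIn.of_eq v (fun w => qphase_insert c ha (y w)) (isQuadIn_xor v (isQuadIn_and v (hy a.1) (hy a.2)) ih)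

/-! ### The dictionary of the quadratic-key face -/

/-- the visible variables at scale `k`: `s_a`, `t_a`, `B_{aa'}`, `p_a`, `c_G` -/
abbrev CVar (k : ℕ) : Type := Fin k ⊕ Fin k ⊕ (Fin k × Fin k) ⊕ Fin k ⊕ Unit

namespace CVar
/-- index of `s_a` -/ abbrev vs (a : Fin k) : CVar k := Sum.inl a
/-- index of `t_a` -/ abbrev vt (a : Fin k) : CVar k := Sum.inr (Sum.inl a)
/-- index of `B_{aa'}` -/ abbrev vB (a a' : Fin k) : CVar k := Sum.inr (Sum.inr (Sum.inl (a, a')))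
/-- index of `p_a` -/ abbrev vp (a : Fin k) : CVar k := Sum.inr (Sum.inr (Sum.inr (Sum.inl a)))
/-- index of `c_G` -/ abbrev vc : CVar k := Sum.inr (Sum.inr (Sum.inr (Sum.inr ())))
end CVar

open CVar in
/-- ★ the CLOSED-FORM valuation of the visible variables at a face parameter `w = (s,t,B,b)`:
`s_a`, `t_a`, `[a<a'] B_{aa'}`, `p_a = ((U_B+U_Bᵀ)s)_a`, `c_G = b ⊕ ⟨t,s⟩ ⊕ Q_B(s)`. -/
def cval (w : QParam k) : CVar k → Bool
  | Sum.inl a => w.1 a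
  | Sum.inr (Sum.inl a) => w.2.1 a
  | Sum.inr (Sum.inr (Sum.inl aa)) => ut w.2.2.1 aa.1 aa.2
  | Sum.inr (Sum.inr (Sum.inr (Sum.inl a))) => polar w.2.2.1 w.1 a
  | Sum.inr (Sum.inr (Sum.inr (Sum.inr _))) => xor w.2.2.2 (xor (bd w.2.1 w.1) (qf w.2.2.1 w.1))

/-- PerceptronDialLaws helper `ut_zm` (decomp-qadv land package; see the module docstring). -/
theorem ut_zm (a a' : Fin k) : ut zm a a' = false := by simp [ut, zm]

open CVar in
/-- the pattern entries of a quadratic-key table with affine data are affine -/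
theorem isAffIn_QP {α β : QParam k → Fin k → Bool} {A B : QParam k → Fin k → Fin k → Bool} (M : Fin k → Fin k → Bool)
    (hα : ∀ a, IsAffIn (cval (k := k)) (fun w => α w a)) (hβ : ∀ a, IsAffIn (cval (k := k)) (fun w => β w a))
    (hA : ∀ a a', IsAffIn (cval (k := k)) (fun w => ut (A w) a a'))
    (hB : ∀ a a', IsAffIn (cval (k := k)) (fun w => ut (B w) a a')) (u u' : Fin k ⊕ Fin k) :
    IsAffIn (cval (k := k)) (fun w => QP (α w) (A w) M (β w) (B w) u u') := by
  rcases u with a | b <;> rcases u' with a' | b'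
  · exact isAffIn_xor _ (isAffIn_const_and _ _ (hα a)) (hA a a')
  · exact isAffIn_const _ (M a b')
  · exact isAffIn_const _ false
  · exact isAffIn_xor _ (isAffIn_const_and _ _ (hβ b)) (hB b b')

/-- PerceptronDialLaws helper `faceG_cube` (decomp-qadv land package; see the module docstring). -/
theorem faceG_cube (m : ℕ) (w : QParam m) : (faceG m w).cube = (faceG₀ m w.1 w.2.1 w.2.2.1).cube := by
  unfold faceG; split <;> rfl

/-- PerceptronDialLaws helper `faceG_const` (decomp-qadv land package; see the module docstring). -/
theorem faceG_const (m : ℕ) (w : QParam m) :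
    (faceG m w).const = xor w.2.2.2 (xor (bd w.2.1 w.1) (qf w.2.2.1 w.1)) := by
  obtain ⟨s, t, B, b⟩ := w
  have h0 : (faceG₀ m s t B).const = xor (bd t s) (qf B s) := rfl
  cases b
  · show (faceG₀ m s t B).const = xor false (xor (bd t s) (qf B s))
    rw [h0, Bool.false_xor]
  · show (flipConst (faceG₀ m s t B)).const = xor true (xor (bd t s) (qf B s))
    rw [show (flipConst (faceG₀ m s t B)).const = !(faceG₀ m s t B).const from rfl, h0, Bool.true_xor]

open CVar in
/-- ★★ THE DICTIONARY: every table bit of the face instance is an affine polynomial (in fact `0`, `1`, a variable, or `t_a ⊕ p_a`)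
in the visible variables. -/
theorem isAffIn_bits (m : ℕ) (idx : AnfIdx (m + m)) :
    IsAffIn (cval (k := m)) (fun w : QParam m => bits (faceInst m w) idx) := by
  obtain ⟨bF, o⟩ := idx
  rcases o with _ | ⟨i, j, l⟩
  · cases bF
    · exact IsAffIn.of_eq _ (g := fun _ => false) (fun w => rfl) (isAffIn_const _ false)
    · exact IsAffIn.of_eq _ (g := fun w => cval w vc) (fun w => faceG_const m w) (isAffIn_var _ vc)
  · have hs : ∀ a, IsAffIn (cval (k := m)) (fun w : QParam m => w.1 a) := fun a => isAffIn_var _ (vs a)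
    have ht : ∀ a, IsAffIn (cval (k := m)) (fun w : QParam m => w.2.1 a) := fun a => isAffIn_var _ (vt a)
    have hB : ∀ a a', IsAffIn (cval (k := m)) (fun w : QParam m => ut w.2.2.1 a a') := fun a a' => isAffIn_var _ (vB a a')
    have hz : ∀ a a', IsAffIn (cval (k := m)) (fun _ : QParam m => ut (zm (k := m)) a a') :=
      fun a a' => IsAffIn.of_eq _ (g := fun _ => false) (fun w => ut_zm a a') (isAffIn_const _ false)
    have hα : ∀ a, IsAffIn (cval (k := m)) (fun w : QParam m => bxor w.2.1 (polar w.2.2.1 w.1) a) :=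
      fun a => isAffIn_xor _ (isAffIn_var _ (vt a)) (isAffIn_var _ (vp a))
    cases bF
    · -- an `F`-bit: `[i=j] ∧ QP s 0 δ t B (i) (l)`
      have e : ∀ w : QParam m, bits (faceInst m w) (false, some (i, j, l))
          = (decide (i = j) && QP w.1 zm (δ m) w.2.1 w.2.2.1 (finSumFinEquiv.symm i) (finSumFinEquiv.symm l)) := fun w => rfl
      exact IsAffIn.of_eq _ e (isAffIn_const_and _ _ (isAffIn_QP (δ m) hs ht hz hB _ _))
    · -- a `G`-bit: `[i=j] ∧ QP (t ⊕ p) B δ s 0 (i) (l)`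
      have e : ∀ w : QParam m, bits (faceInst m w) (true, some (i, j, l))
          = (decide (i = j) && QP (bxor w.2.1 (polar w.2.2.1 w.1)) w.2.2.1 (δ m) w.1 zm
              (finSumFinEquiv.symm i) (finSumFinEquiv.symm l)) := fun w => by
        show (faceG m w).cube i j l = _
        rw [faceG_cube]; rfl
      exact IsAffIn.of_eq _ e (isAffIn_const_and _ _ (isAffIn_QP (δ m) hα hs hB hz _ _))

/-- ★★★ `CoreBias` — THE PRESENTATION-FREE LEAF beneath `KeyBias`: for every polynomial `p`, at some scale `m`, EVERY function of
the face parameter `(s,t,B,b) ∈ 𝔽₂^m × 𝔽₂^m × 𝔽₂^{m×m} × 𝔽₂` that is a quadratic polynomial over `𝔽₂` in the variables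
`s_a, t_a, [a<a']B_{aa'}, p_a = ((U_B+U_Bᵀ)s)_a, c_G = b ⊕ ⟨t,s⟩ ⊕ Q_B(s)` has correlation `< 1/(2p(2m))` with `(-1)^b`:
`2·p(2m)·|Σ_w (-1)^{b} (-1)^{f(w)}| < 2^{2m+m²+1}`.  A bare exponential-sum inequality over `𝔽₂` (no table, slice or circuit). -/
def CoreBias : Prop :=
  ∀ p : Polynomial ℕ, ∃ m : ℕ, ∀ f : QParam m → Bool, IsQuadIn (cval (k := m)) f →
    2 * ((p.eval (m + m) : ℕ) : ℝ) * |∑ w, signOf w.2.2.2 * signOf (f w)| < Fintype.card (QParam m)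

/-- ★★★ [kernel] `CoreBias → KeyBias` (hence `→ VoteRung2NU → VoteRung2`). -/
theorem keyBias_of_coreBias (h : CoreBias) : KeyBias := by
  intro p
  obtain ⟨m, hm⟩ := h p
  refine ⟨m, fun c S => ?_⟩
  exact hm (fun w => qphase c S (bits (faceInst m w))) (isQuadIn_qphase _ (isAffIn_bits m) c S)

/-- PerceptronDialLaws helper `voteRung2_of_coreBias` (decomp-qadv land package; see the module docstring). -/
theorem voteRung2_of_coreBias (h : CoreBias) : VoteRung2 := voteRung2_of_keyBias (keyBias_of_coreBias h)

end Core

end Summit.QuantumAdvantage.QuantumAdvantage.Theorems.PerceptronDial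

end
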